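import Summits.ResolutionOfSingularities.ResolutionOfSingularities.Theorems.WeightedInvariantAQSBaseChangeLexMaxPrelim
import Literature.AlgebraicGeometry.Resolution.OrderFlatLocalHom
import HarnessLib

/-!
# The lex-maximal weighted centre germ is stable under flat unramified local extensions with separable residue field
# extension (Abramovich–Quek–Schober, Thm 3.5 «`J` is stable under base change to separable field extensions»)

Route `ResolutionOfSingularities/WeightedInvariant`, door crux `HypersurfaceCentreConstruction`
(stmt-ResolutionOfSingularities-19897) — OURS, helper; e-ladder `e = 1`, piece **(o25-δ)** «separable base change of the
Abramovich–Quek–Schober centre in the kernel» (res-D-pv-025 AS stub-10; CHAIN w43 v4.18 (3)), brick **(δ1c) — the LOCAL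
THEOREM**: for a faithfully flat local homomorphism `φ : S → S′` of two-dimensional regular local rings with
`𝔪_S · S′ = 𝔪_{S′}` whose residue field extension is relatively `p`-radically closed, the image of a lex-maximal
admissible weighted centre germ `(x; w; ℓ)` of `(f) ⊆ S` (`IsLexMaxWeightedCentreGerm`, vendored predicate of
`Literature/…/HypersurfaceHeightTwoWeightedCentre.lean`) is the lex-maximal admissible weighted centre germ of
`(φ f) ⊆ S′` (`isLexMaxWeightedCentreGerm_map`).

Proof (certificate-free): the regular system of parameters, the weights, admissibility and the level `ℓ = r·ν`
(`ν = ord f`, `level_eq`) transport directly; the order is preserved (`Literature.…mem_pow_maximalIdeal_iff_of_map_maximalIdeal_eq`).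
MAXIMALITY in `S′`: a competitor `(y′; (r′, q′); ℓ′)` has `ℓ′ ≤ r′ν` (`le_pow_of_weights_le`); at equality its slope `r′/q′`
exceeds `r/q` only if — by res-type-092's and res-type-070's `AQSHeightTwo` comparison lemmas IN `S′` — either `(φx, φy)` itself carries `φ f`
at a steeper slope (`exists_steeper_of_not_dvd`, non-integer slope), which CONTRACTS to `S` by faithful flatness and contradicts
maximality there; or (integer slope `b ≥ 2`) `y′ = a(φy - λ′ φx^b)` (`exists_order_ge`, `exists_steepen_form_of_le`) and
`φ f ≡ c′(φy - λ′φx^b)^ν` modulo `𝒥′_{bν+1}` (`le_span_pow_sup_of_lt`), which DESCENDS to `S` (`exists_steepening_of_map`,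
file `…AQSBaseChangeDescent`) and produces the steeper admissible datum `(y - λ x^b, x; bν+1, ν)` in `S`; or (slope `1`)
`φ f ≡ c′ y′^ν` modulo `𝔪′^{ν+1}` (`le_span_pow_sup_pow`), which descends by `exists_tangent_line_of_map`.  UNIQUENESS in `S′`
is `filtration_eq_of_mem_of_mem` (slope `> 1`) or trivial (slope `1`: the `𝔪`-adic filtration).

Def-free; nothing here is a claim about Hironaka's problem.  AI-written; weaker than expert review.
[cite: AbramovichQuekSchober2025, Thm 1.3 (1) / Thm 3.5, proof p. 7 L94 – p. 8 L40]
-/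

noncomputable section

set_option linter.dupNamespace false -- mandated namespace of this single-conjunct summit

namespace Summit.ResolutionOfSingularities.ResolutionOfSingularities.Theorems.AQSBaseChange

open IsLocalRing Literature.AlgebraicGeometry.Resolution
open Summit.ResolutionOfSingularities.ResolutionOfSingularities.Theorems.AQSHeightTwo

universe u v

/-! ## The local theorem -/

section Contraction

variable {S : Type u} {S' : Type v} [CommRing S] [CommRing S'] [Algebra S S'] [Module.FaithfullyFlat S S']

/-- Contraction of weighted monomial ideals of `(φ x, φ y)`. [folklore] -/
theorem mem_weightedMonomialIdeal_of_map {x y f : S} {w : Fin 2 → ℕ} {n : ℕ}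
    (hf : algebraMap S S' f ∈ weightedMonomialIdeal ![algebraMap S S' x, algebraMap S S' y] w n) :
    f ∈ weightedMonomialIdeal ![x, y] w n := by
  rw [← map_weightedMonomialIdeal_two, ← Ideal.mem_comap, Ideal.comap_map_eq_self_of_faithfullyFlat] at hf
  exact hf

end Contraction

section Transport

variable {S S' : Type} [CommRing S] [CommRing S'] [IsRegularLocalRing S] [IsRegularLocalRing S']
  [Algebra S S'] [IsLocalHom (algebraMap S S')] [Module.FaithfullyFlat S S']
  (hdim : ringKrullDim S = (2 : ℕ)) (hdim' : ringKrullDim S' = (2 : ℕ))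
  (h𝔪 : (maximalIdeal S).map (algebraMap S S') = maximalIdeal S')
  (p : ℕ) [ExpChar (ResidueField S') p]
  (hcl : ∀ z : ResidueField S', z ^ p ∈ (ResidueField.map (algebraMap S S')).range →
    z ∈ (ResidueField.map (algebraMap S S')).range)

include hdim hdim' h𝔪 hcl in
/-- **Abramovich–Quek–Schober's separable base change, local form.**  Let `φ : S → S′` be a faithfully flat local
homomorphism of two-dimensional regular local rings with `𝔪_S · S′ = 𝔪_{S′}`, whose residue field extension is relatively
`p`-radically closed (`p` the exponential characteristic).  If `(x; w; ℓ)` is the lex-maximal admissible weighted centre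
germ of `(f) ⊆ S`, then `(φ ∘ x; w; ℓ)` is the lex-maximal admissible weighted centre germ of `(φ f) ⊆ S′`.
[cite: AbramovichQuekSchober2025, Thm 3.5 («`J` is stable under base change to separable field extensions»), proof p. 7–8] -/
theorem isLexMaxWeightedCentreGerm_map {f : S} {x : Fin 2 → S} {w : Fin 2 → ℕ} {ℓ : ℕ}
    (h : IsLexMaxWeightedCentreGerm S (Ideal.span {f}) x w ℓ) :
    IsLexMaxWeightedCentreGerm S' (Ideal.span {algebraMap S S' f}) (fun i => algebraMap S S' (x i)) w ℓ := by
  classical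
  obtain ⟨ν, hν, hℓν, hfν, hford⟩ := level_eq h
  obtain ⟨hspan, hpos, hcop, hle, hℓ, hdvd, hadm, hmax, huniq⟩ := h
  -- `x 0` is the ORDER variable (weight `w 0 = r`), `x 1` the transversal one (weight `w 1 = q ≤ r`)
  have hw : w = ![w 0, w 1] := by funext i; fin_cases i <;> rfl
  have hxv : x = ![x 0, x 1] := by funext i; fin_cases i <;> rfl
  have hrangeS : ∀ v : Fin 2 → S, Set.range v = {v 0, v 1} := fun v => by
    have hv : v = ![v 0, v 1] := by funext i; fin_cases i <;> rfl
    conv_lhs => rw [hv]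
    exact Matrix.range_cons_cons_empty _ _ _
  have hrangeS' : ∀ v : Fin 2 → S', Set.range v = {v 0, v 1} := fun v => by
    have hv : v = ![v 0, v 1] := by funext i; fin_cases i <;> rfl
    conv_lhs => rw [hv]
    exact Matrix.range_cons_cons_empty _ _ _
  have hx𝔪 : ∀ i, x i ∈ maximalIdeal S := fun i => hspan ▸ Ideal.subset_span ⟨i, rfl⟩
  have hxy : Ideal.span {x 1, x 0} = maximalIdeal S := by
    rw [← hspan, hrangeS, Ideal.span_pair_comm]
  have hxy' : Ideal.span {algebraMap S S' (x 1), algebraMap S S' (x 0)} = maximalIdeal S' :=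
    span_pair_map_eq _ h𝔪 hxy
  have hx𝔪' : ∀ i, algebraMap S S' (x i) ∈ maximalIdeal S' := fun i =>
    h𝔪 ▸ Ideal.mem_map_of_mem _ (hx𝔪 i)
  have hford' : algebraMap S S' f ∉ maximalIdeal S' ^ (ν + 1) := fun h' =>
    hford ((mem_pow_maximalIdeal_iff_of_map_maximalIdeal_eq h𝔪 (ν + 1) f).mpr h')
  -- `f ∈ 𝒥_{rν}((x₁, x₀); (q, r))` in `S` and in `S′`
  have hfS : f ∈ weightedMonomialIdeal ![x 1, x 0] ![w 1, w 0] (w 0 * ν) := by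
    have hf : f ∈ weightedMonomialIdeal x w ℓ := (Ideal.span_singleton_le_iff_mem _).mp hadm
    rwa [hxv, hw, weightedMonomialIdeal_swap, hℓν] at hf
  have hfS' : algebraMap S S' f ∈
      weightedMonomialIdeal ![algebraMap S S' (x 1), algebraMap S S' (x 0)] ![w 1, w 0] (w 0 * ν) := by
    rw [← map_weightedMonomialIdeal_two]; exact Ideal.mem_map_of_mem _ hfS
  -- how `hmax` is used: an admissible datum `((b, a); (q'', r''); r''ν)` in `S` forces `r''/q'' ≤ r/q`
  have hmaxS : ∀ (a b : S), Ideal.span {b, a} = maximalIdeal S → ∀ (q'' r'' : ℕ), 0 < q'' → q'' ≤ r'' →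
      f ∈ weightedMonomialIdeal ![b, a] ![q'', r''] (r'' * ν) → r'' * w 1 ≤ w 0 * q'' := by
    intro a b hab q'' r'' hq'' hqr'' hf
    have hspan' : Ideal.span (Set.range ![a, b]) = maximalIdeal S := by
      rw [hrangeS]
      simpa [Ideal.span_pair_comm] using hab
    have hadm' : Ideal.span {f} ≤ weightedMonomialIdeal ![a, b] ![r'', q''] (r'' * ν) := by
      rw [Ideal.span_singleton_le_iff_mem, weightedMonomialIdeal_swap]; exact hf
    rcases hmax ![a, b] ![r'', q''] (r'' * ν) hspan'
        (fun i => by fin_cases i <;> simp [hq'', hq''.trans_le hqr''])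
        (by simpa using hqr'') (Nat.mul_pos (hq''.trans_le hqr'') hν) hadm' with hlt | ⟨-, hle'⟩
    · exfalso
      simp only [Matrix.cons_val_zero] at hlt
      rw [hℓν] at hlt
      nlinarith
    · simp only [Matrix.cons_val_one, Matrix.cons_val_zero] at hle'
      rw [hℓν] at hle'
      have : r'' * w 1 * ν ≤ w 0 * q'' * ν := by nlinarith
      exact Nat.le_of_mul_le_mul_right this hν
  refine ⟨?_, hpos, hcop, hle, hℓ, hdvd, ?_, ?_, ?_⟩
  · -- regular system of parameters
    rw [show (fun i => algebraMap S S' (x i)) = algebraMap S S' ∘ x from rfl, Set.range_comp, ← Ideal.map_span,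
      hspan, h𝔪]
  · -- admissibility
    rw [Ideal.span_singleton_le_iff_mem, ← weightedMonomialIdeal_map]
    exact Ideal.mem_map_of_mem _ ((Ideal.span_singleton_le_iff_mem _).mp hadm)
  · -- MAXIMALITY
    intro y' w' ℓ' hy' hw'pos hw'le hℓ' hadm'
    have hyv : y' = ![y' 0, y' 1] := by funext i; fin_cases i <;> rfl
    have hwv : w' = ![w' 0, w' 1] := by funext i; fin_cases i <;> rfl
    have hy'𝔪 : ∀ i, y' i ∈ maximalIdeal S' := fun i => hy' ▸ Ideal.subset_span ⟨i, rfl⟩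
    have hxy'' : Ideal.span {y' 1, y' 0} = maximalIdeal S' := by
      rw [← hy', hrangeS', Ideal.span_pair_comm]
    have hf' : algebraMap S S' f ∈ weightedMonomialIdeal ![y' 1, y' 0] ![w' 1, w' 0] ℓ' := by
      have := (Ideal.span_singleton_le_iff_mem _).mp hadm'
      rwa [hyv, hwv, weightedMonomialIdeal_swap] at this
    -- Step A: the first invariant is at most `ν`
    have hA : ℓ' ≤ w' 0 * ν := by
      by_contra hA
      push Not at hA
      apply hford'
      exact le_pow_of_weights_le (hy'𝔪 1) (hy'𝔪 0) hw'le le_rfl ν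
        (weightedMonomialIdeal_antitone _ _ (by linarith) hf')
    rcases hA.lt_or_eq with hlt | heq
    · left
      rw [hℓν]
      nlinarith [hpos 0]
    right
    refine ⟨by rw [hℓν, heq]; ring, ?_⟩
    rw [hℓν, heq]
    suffices hs : w' 0 * w 1 ≤ w 0 * w' 1 by nlinarith
    by_contra hcon
    push Not at hcon
    -- the competitor `((y'₁, y'₀); (q', r'); r'ν)` has slope `r'/q' > r/q`
    have hq' : 0 < w' 1 := hw'pos 1
    have hf'ν : algebraMap S S' f ∈ weightedMonomialIdeal ![y' 1, y' 0] ![w' 1, w' 0] (w' 0 * ν) := by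
      rw [← heq]; exact hf'
    have hlt : w 0 * w' 1 < w' 0 * w 1 := hcon
    by_cases hq1 : w 1 = 1
    · by_cases hr1 : w 0 = 1
      · -- slope `1`: the tangent cone of `φ f` would be a `ν`-fold line over `κ′`, hence over `κ`
        have hlt' : w' 1 < w' 0 := by rw [hq1, hr1] at hlt; simpa using hlt
        have hfν' : f ∈ maximalIdeal S ^ ν := hfν
        have hcore := le_span_pow_sup_pow hxy'' hlt' ν hf'ν
        obtain ⟨c', m', hc', hm', hfe⟩ := exists_unit_mul_pow_add (hy'𝔪 0) hcore hford'
        have h1 : algebraMap S S' f - c' * y' 0 ^ ν ∈ maximalIdeal S' ^ (ν + 1) := by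
          rw [hfe, add_sub_cancel_left]; exact hm'
        obtain ⟨x₀, y₀, c, hx₀y₀, -, hdesc⟩ :=
          exists_tangent_line_of_map hdim hdim' h𝔪 p hcl hxy hν hfν' hxy'' hc' h1
        have hmem : f ∈ weightedMonomialIdeal ![x₀, y₀] ![ν, ν + 1] ((ν + 1) * ν) := by
          have hf2 : f ∈ Ideal.span {y₀ ^ ν} ⊔ maximalIdeal S ^ (ν + 1) :=
            Submodule.mem_sup.mpr ⟨c * y₀ ^ ν, Ideal.mem_span_singleton'.mpr ⟨c, rfl⟩, _, hdesc, by ring⟩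
          have hle2 : Ideal.span {y₀ ^ ν} ⊔ maximalIdeal S ^ (ν + 1) ≤
              weightedMonomialIdeal ![x₀, y₀] ![ν, ν + 1] ((ν + 1) * ν) := by
            refine sup_le ?_ ?_
            · rw [Ideal.span_singleton_le_iff_mem]
              have := monomial_mem x₀ y₀ ν (ν + 1) (i := 0) (j := ν) (n := (ν + 1) * ν) (by ring_nf; omega)
              rwa [pow_zero, one_mul] at this
            · have := maximalIdeal_pow_le hx₀y₀ (Nat.le_succ ν) (ν + 1)
              rwa [Nat.mul_comm] at this
          exact hle2 hf2
        have := hmaxS y₀ x₀ hx₀y₀ ν (ν + 1) hν (Nat.le_succ ν) hmem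
        rw [hq1, hr1] at this
        omega
      · -- integer slope `b = w 0 ≥ 2`: a steepening over `S′` descends to `S`
        have hb2 : 2 ≤ w 0 := by
          have : w 1 ≤ w 0 := hle
          omega
        have hbq' : w 0 * w' 1 < w' 0 := by rw [hq1, mul_one] at hlt; exact hlt
        have hlt' : w' 1 < w' 0 := lt_of_le_of_lt (Nat.le_mul_of_pos_left _ (by omega)) hbq'
        rw [hq1] at hfS hfS'
        obtain ⟨t, hbt, hmemt⟩ := exists_order_ge hdim' hxy' hxy'' hν hford' Nat.one_pos hq' hlt'
          (by rw [mul_one]; exact hbq'.le) hfS' hf'ν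
        rw [one_mul] at hbt
        obtain ⟨a, lam', ha, hy'0⟩ := exists_steepen_form_of_le hdim' hxy' hxy'' hb2 hbt hmemt
        -- the steepened parameter `z' = φx₀ - λ' φx₁^b`
        have hz'span : Ideal.span {algebraMap S S' (x 1), y' 0} = maximalIdeal S' := by
          rw [hy'0, span_pair_unit_mul_right _ _ ha, LocalGameEFTSteepening.span_pair_steepen_eq _ _ _ (by omega : 1 ≤ w 0), hxy']
        have hJz : ∀ n, weightedMonomialIdeal ![algebraMap S S' (x 1), y' 0] ![1, w 0] n =
            weightedMonomialIdeal ![algebraMap S S' (x 1), algebraMap S S' (x 0)] ![1, w 0] n := by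
          intro n
          rw [hy'0, eq_of_snd_unit_mul _ _ ha,
            show algebraMap S S' (x 0) - lam' * algebraMap S S' (x 1) ^ w 0 =
              1 * algebraMap S S' (x 0) + -(lam' * algebraMap S S' (x 1) ^ w 0) by ring]
          exact eq_of_snd_eq_unit_mul_add hxy' isUnit_one hb2
            (neg_mem (Ideal.mul_mem_left _ _ (Ideal.pow_mem_pow (hx𝔪' 1) _))) (by omega) (by omega) n
        have hf'' : algebraMap S S' f ∈ weightedMonomialIdeal ![algebraMap S S' (x 1), y' 0] ![w' 1, w' 0] (w' 0 * ν) := by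
          rw [← eq_of_fst hz'span hxy'' hlt'.le]; exact hf'ν
        have hcore := le_span_pow_sup_of_lt (algebraMap S S' (x 1)) (y' 0) hbq' ν hf''
        rw [hJz] at hcore
        obtain ⟨s0, hs0, g, hg, hfe⟩ := Submodule.mem_sup.mp hcore
        obtain ⟨s, rfl⟩ := Ideal.mem_span_singleton'.mp hs0
        -- `φ f = (s a^ν) · (φx₀ - λ'φx₁^b)^ν + g`
        have hfe' : algebraMap S S' f - (s * a ^ ν) * (algebraMap S S' (x 0) - lam' * algebraMap S S' (x 1) ^ w 0) ^ ν = g := by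
          rw [← hfe, hy'0, mul_pow]; ring
        by_cases hc' : IsUnit (s * a ^ ν)
        · -- descend the steepening and contradict maximality in `S`
          have h1 : algebraMap S S' f - (s * a ^ ν) *
              (algebraMap S S' (x 0) - lam' * algebraMap S S' (x 1) ^ w 0) ^ ν ∈
              weightedMonomialIdeal ![algebraMap S S' (x 1), algebraMap S S' (x 0)] ![1, w 0] (w 0 * ν + 1) := by
            rw [hfe']; exact hg
          obtain ⟨c, lam, hc, hdesc⟩ :=
            exists_steepening_of_map hdim hdim' h𝔪 p hcl hxy (by omega) hν hfS hc' h1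
          set z : S := x 0 - lam * x 1 ^ w 0 with hz
          have hzspan : Ideal.span {x 1, z} = maximalIdeal S := by
            rw [hz, LocalGameEFTSteepening.span_pair_steepen_eq _ _ _ (by omega : 1 ≤ w 0), hxy]
          have hJzS : ∀ n, weightedMonomialIdeal ![x 1, z] ![1, w 0] n = weightedMonomialIdeal ![x 1, x 0] ![1, w 0] n := by
            intro n
            rw [hz, show x 0 - lam * x 1 ^ w 0 = 1 * x 0 + -(lam * x 1 ^ w 0) by ring]
            exact eq_of_snd_eq_unit_mul_add hxy isUnit_one hb2
              (neg_mem (Ideal.mul_mem_left _ _ (Ideal.pow_mem_pow (hx𝔪 1) _))) (by omega) (by omega) n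
          have hmem : f ∈ weightedMonomialIdeal ![x 1, z] ![ν, w 0 * ν + 1] ((w 0 * ν + 1) * ν) := by
            refine span_pow_sup_le_steeper (x 1) z hν (Submodule.mem_sup.mpr ⟨c * z ^ ν,
              Ideal.mem_span_singleton'.mpr ⟨c, rfl⟩, f - c * z ^ ν, ?_, by ring⟩)
            rw [hJzS]; exact hdesc
          have := hmaxS z (x 1) hzspan ν (w 0 * ν + 1) hν (by nlinarith) hmem
          rw [hq1] at this
          nlinarith
        · -- `s a^ν ∈ 𝔪′`: then `φ f ∈ 𝒥′_{bν+1}` already, which contracts to `S`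
          have hc'𝔪 : s * a ^ ν ∈ maximalIdeal S' := (IsLocalRing.mem_maximalIdeal _).mpr hc'
          have hz'J : algebraMap S S' (x 0) - lam' * algebraMap S S' (x 1) ^ w 0 ∈
              weightedMonomialIdeal ![algebraMap S S' (x 1), algebraMap S S' (x 0)] ![1, w 0] (w 0) := by
            refine Ideal.sub_mem _ ?_ (Ideal.mul_mem_left _ _ ?_)
            · have := monomial_mem (algebraMap S S' (x 1)) (algebraMap S S' (x 0)) 1 (w 0) (i := 0) (j := 1)
                (n := w 0) (by simp)
              simpa using this
            · have := monomial_mem (algebraMap S S' (x 1)) (algebraMap S S' (x 0)) 1 (w 0) (i := w 0) (j := 0)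
                (n := w 0) (by simp)
              simpa using this
          have hprod : (s * a ^ ν) * (algebraMap S S' (x 0) - lam' * algebraMap S S' (x 1) ^ w 0) ^ ν ∈
              weightedMonomialIdeal ![algebraMap S S' (x 1), algebraMap S S' (x 0)] ![1, w 0] (w 0 * ν + 1) := by
            rw [add_comm]
            exact weightedMonomialIdeal_mul_le _ _ 1 (w 0 * ν)
              (Ideal.mul_mem_mul (maximalIdeal_le hxy' (by omega : 1 ≤ w 0) hc'𝔪) (pow_mem_weightedMonomialIdeal_mul _ _ hz'J ν))
          have hfJ' : algebraMap S S' f ∈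
              weightedMonomialIdeal ![algebraMap S S' (x 1), algebraMap S S' (x 0)] ![1, w 0] (w 0 * ν + 1) := by
            have : algebraMap S S' f = (s * a ^ ν) *
                (algebraMap S S' (x 0) - lam' * algebraMap S S' (x 1) ^ w 0) ^ ν + g := by rw [← hfe']; ring
            rw [this]; exact Ideal.add_mem _ hprod hg
          have hfJ : f ∈ weightedMonomialIdeal ![x 1, x 0] ![1, w 0] (w 0 * ν + 1) := mem_weightedMonomialIdeal_of_map hfJ'
          have hmem : f ∈ weightedMonomialIdeal ![x 1, x 0] ![ν, w 0 * ν + 1] ((w 0 * ν + 1) * ν) :=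
            span_pow_sup_le_steeper (x 1) (x 0) hν (Ideal.mem_sup_right hfJ)
          have := hmaxS (x 0) (x 1) hxy ν (w 0 * ν + 1) hν (by nlinarith) hmem
          rw [hq1] at this
          nlinarith
    · -- non-integer slope: `(φx₁, φx₀)` itself carries `φ f` at a steeper slope, which contracts to `S`
      have hndvd : ¬ w 1 ∣ w 0 := fun hd => hq1 (Nat.Coprime.eq_one_of_dvd hcop.symm hd)
      have hqr : w 1 < w 0 := lt_of_le_of_ne hle (fun he => hndvd (he ▸ dvd_rfl))
      obtain ⟨q'', r'', hq'', hlt1, -, hmem'⟩ :=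
        exists_steeper_of_not_dvd hdim' hxy' hxy'' hν hford' (hpos 1) hqr hndvd hq' hlt hfS' hf'ν
      have hmem : f ∈ weightedMonomialIdeal ![x 1, x 0] ![q'', r''] (r'' * ν) := mem_weightedMonomialIdeal_of_map hmem'
      have := hmaxS (x 0) (x 1) hxy q'' r'' hq'' (by nlinarith) hmem
      nlinarith
  · -- UNIQUENESS
    intro y' hy' hadm' n
    have hyv : y' = ![y' 0, y' 1] := by funext i; fin_cases i <;> rfl
    have hxy'' : Ideal.span {y' 1, y' 0} = maximalIdeal S' := by
      rw [← hy', hrangeS', Ideal.span_pair_comm]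
    have hf' : algebraMap S S' f ∈ weightedMonomialIdeal ![y' 1, y' 0] ![w 1, w 0] (w 0 * ν) := by
      have := (Ideal.span_singleton_le_iff_mem _).mp hadm'
      rwa [hyv, hw, weightedMonomialIdeal_swap, hℓν] at this
    rw [hyv, show (fun i => algebraMap S S' (x i)) = ![algebraMap S S' (x 0), algebraMap S S' (x 1)] from
      (by funext i; fin_cases i <;> rfl), hw, weightedMonomialIdeal_swap (y' 0), weightedMonomialIdeal_swap (algebraMap S S' (x 0))]
    by_cases hqr : w 1 < w 0
    · exact filtration_eq_of_mem_of_mem hdim' hxy' hxy'' hν hford' (hpos 1) hqr hfS' hf' n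
    · -- slope `1`: both filtrations are the `𝔪′`-adic one
      have hq1 : w 1 = w 0 := le_antisymm hle (not_lt.mp hqr)
      have hr1 : w 0 = 1 := by
        have h2 : Nat.gcd (w 0) (w 0) = 1 := (hq1 ▸ hcop : Nat.Coprime (w 0) (w 0))
        rwa [Nat.gcd_self] at h2
      rw [hq1, hr1, LocalGameEFTSteepening.weightedMonomialIdeal_one_eq_pow,
        LocalGameEFTSteepening.weightedMonomialIdeal_one_eq_pow, hxy'', hxy']

end Transport

end Summit.ResolutionOfSingularities.ResolutionOfSingularities.Theorems.AQSBaseChange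

end
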